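import Summits.CriticalPhenomena.SAWScalingLimit.Theorems.SAWDefectDecoherencePickHalfPlaneDefs
import Summits.CriticalPhenomena.SAWScalingLimit.Theorems.SAWDefectDecoherenceBoundaryClosureRBoundaryExactness
import Summits.CriticalPhenomena.SAWScalingLimit.Theorems.SAWDefectDecoherenceSpinShift
import Literature.Probability.RandomPlanarGeometry.HexParafermionProofs
import HarnessLib

/-!
# Crux `BoundaryClosureR` (stmt-CriticalPhenomena-14004), line `pick-half-plane`: the dressed
boundary-arrival identity, the TAME one-sided bound, and the exact gate

Helper file of the lead (serves `stub_halfPlaneInputs`, boundary half `BoundaryHalfPlaneBounds`),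
now UNCONDITIONAL thanks to the landed boundary exactness (E2)–(E4)
(`…Theorems.PickHalfPlane.BoundaryExactness.stub_boundaryExactness`):

(this file: the gate; companion `…BoundaryClosureRDressedArrival.lean`: the dressed identity and
the tame bound)

* `boundaryTerm_sum_eq` — total boundary flux with the root split off:
  `Σ_{boundary darts ≠ root} (mid − c_v)F({v,t}) = (c_w − c_u)/2` (summed DCS Lemma 1,
  `hexFlux_eq_zero_of_satisfiesVertexRelations`, and `F(a) = 1`);
* `dressed_sum_re_im` — normalised: `Σ Re(D/A) = 1`, `Σ Im(D/A) = 0`, `A = (c_w − c_u)/2` — the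
  general-domain form of DCS's identity (5): by (E2) each reached dart has `D/A = e^{i(3/8)W} Z`;
* `tame_piClass_mass_le` (registered sub-goal `stub_halfPlaneInputs_tameBound`) — if every
  boundary winding from the root lies in `[−π, π]`, the arrival mass of the class of winding `+π`
  is `≤ 1/(2cos(3π/8))`, the SHARP half-plane one-sided constant (strip instance:
  `Literature…HexSAWHalfSideArrival`); this is what makes Claim D hold with `M = 0` on the root's
  own floor in tame domains;
* `gate_step_re_eq_zero`, `potential_floor_step`, `gate_re_eq_zero` — the gate through `b` is
  mapped INTO the imaginary axis by every potential (from (E2)+(E3)).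
-/

noncomputable section

open scoped BigOperators ComplexConjugate
open Literature.Probability.LatticeModels Literature.Probability.RandomPlanarGeometry
open Literature.Probability.RandomPlanarGeometry.SAW
open Literature.Barriers.CriticalPhenomena Literature.Barriers.CriticalPhenomena.HexGreen
open Summit.CriticalPhenomena.SAWScalingLimit.Theorems.PickHalfPlane

namespace Summit.CriticalPhenomena.SAWScalingLimit.Theorems.PickHalfPlane.Gate

/-! ### The exact gate -/

/-- **The gate lies on the imaginary axis** (the anchor of the engine, from (E2)+(E3)): on a flat
floor segment `k₁ … k₂` of row `m` that does not contain the root, for two floor edges `kb`, `k` of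
the segment reached by walks from the root, the increment of ANY potential across `floorEdge k m`
(which is `(mid − c_up)·F(floorEdge k m)`, see `IsPotential`) divided by `F(floorEdge kb m)` is
purely imaginary — so `Re h_δ` is constant (`= 0`) along the gate through `b_δ`.  Division by a
vanishing `F(b)` is the junk value `0`, for which the statement holds trivially. [folklore] -/
theorem gate_step_re_eq_zero {Λ : Finset HexVertex}
    (hΛ : hexDomainSimplyConnected Λ) {u w : HexVertex} (huw : hexGraph.Adj u w) (hu : u ∉ Λ)
    (hw : w ∈ Λ) {m k₁ k₂ : ℤ} (hfl : IsFlatFloor Λ m k₁ k₂)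
    (hroot : ∀ k : ℤ, k₁ ≤ k → k ≤ k₂ → floorEdge k m ≠ s(u, w))
    {kb k : ℤ} (hkb₁ : k₁ ≤ kb) (hkb₂ : kb ≤ k₂) (hk₁ : k₁ ≤ k) (hk₂ : k ≤ k₂)
    (γb : HexMidEdgeSAW Λ s(u, w) (floorEdge kb m)) (γ : HexMidEdgeSAW Λ s(u, w) (floorEdge k m)) :
    ((hexMidpoint (floorEdge k m) - hexCenter (upFace k m)) *
        hexParafermionicObservable Λ s(u, w) hexCriticalFugacity (5 / 8) (floorEdge k m) /
      hexParafermionicObservable Λ s(u, w) hexCriticalFugacity (5 / 8) (floorEdge kb m)).re = 0 := by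
  classical
  have hE2 := Summit.CriticalPhenomena.SAWScalingLimit.Theorems.PickHalfPlane.BoundaryExactness.stub_boundaryExactness.1
  have hE3 := Summit.CriticalPhenomena.SAWScalingLimit.Theorems.PickHalfPlane.BoundaryExactness.stub_boundaryExactness.2.1
  have hk := hfl k hk₁ hk₂
  have hb := hfl kb hkb₁ hkb₂
  have e2k := hE2 Λ hΛ u w huw hu hw (belowFace k m) (upFace k m) (adj_belowFace_upFace k m)
    hk.2.1 hk.1 (hroot k hk₁ hk₂) γ
  have e2b := hE2 Λ hΛ u w huw hu hw (belowFace kb m) (upFace kb m) (adj_belowFace_upFace kb m)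
    hb.2.1 hb.1 (hroot kb hkb₁ hkb₂) γb
  have e3 : @HexMidEdgeSAW.winding Λ s(u, w) s(belowFace k m, upFace k m) γ =
      @HexMidEdgeSAW.winding Λ s(u, w) s(belowFace kb m, upFace kb m) γb :=
    hE3 Λ hΛ u w huw hu hw m k₁ k₂ hfl hroot kb k hkb₁ hkb₂ hk₁ hk₂ γb γ
  -- both half-edge vectors are the same purely imaginary number `d`
  have hdk : hexMidpoint s(belowFace k m, upFace k m) - hexCenter (upFace k m) =
      (1 - 2 * triZeta) / 6 := hexMidpoint_floorEdge_sub k m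
  have hdb : hexMidpoint s(belowFace kb m, upFace kb m) - hexCenter (upFace kb m) =
      (1 - 2 * triZeta) / 6 := hexMidpoint_floorEdge_sub kb m
  rw [hdk, e3] at e2k
  rw [hdb] at e2b
  rw [hexMidpoint_floorEdge_sub k m]
  set d : ℂ := (1 - 2 * triZeta) / 6 with hd
  set Fk := hexParafermionicObservable Λ s(u, w) hexCriticalFugacity (5 / 8) s(belowFace k m, upFace k m)
  set Fb := hexParafermionicObservable Λ s(u, w) hexCriticalFugacity (5 / 8) s(belowFace kb m, upFace kb m)
  set A : ℂ := (hexCenter w - hexCenter u) / 2 *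
    Complex.exp (Complex.I * (3 / 8 : ℂ) * (γb.winding : ℂ))
  set rk : ℝ := ‖hexParafermionicObservable Λ s(u, w) hexCriticalFugacity 0 s(belowFace k m, upFace k m)‖
  set rb : ℝ := ‖hexParafermionicObservable Λ s(u, w) hexCriticalFugacity 0 s(belowFace kb m, upFace kb m)‖
  change d * Fk = A * (rk : ℂ) at e2k
  change d * Fb = A * (rb : ℂ) at e2b
  show (d * Fk / Fb).re = 0
  have hdre : d.re = 0 := by rw [hd]; simp [triZeta_re]
  have hdne : d ≠ 0 := by
    rw [hd]; apply div_ne_zero _ (by norm_num)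
    intro h
    have := congrArg Complex.im h
    simp [triZeta_im] at this
  by_cases hFb : Fb = 0
  · simp [hFb]
  have hrb : (rb : ℂ) ≠ 0 := by
    intro h0
    apply hFb
    have : d * Fb = 0 := by rw [e2b, h0, mul_zero]
    exact (mul_eq_zero.1 this).resolve_left hdne
  have hA : A ≠ 0 := by
    intro h0; apply hFb
    have : d * Fb = 0 := by rw [e2b, h0, zero_mul]
    exact (mul_eq_zero.1 this).resolve_left hdne
  -- `d Fk / Fb = d · (rk / rb)` and `d` is purely imaginary
  have key : d * Fk / Fb = d * ((rk : ℂ) / (rb : ℂ)) := by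
    have hFb' : Fb = A * (rb : ℂ) / d := by
      rw [← e2b]; field_simp
    rw [e2k, hFb']
    field_simp
  rw [key, ← Complex.ofReal_div, Complex.mul_re, Complex.ofReal_re, Complex.ofReal_im, hdre]
  ring

/-- One step of ANY potential along the floor sites `(k, m) → (k+1, m)` of a flat floor is the
half-edge increment `(mid − c_up)·F(floorEdge k m)` (the centre of `upFace k m` lies to the LEFT of
the eastward 𝕋-edge; orientation clause of `IsPotential`). [folklore] -/
theorem potential_floor_step {Λ : Finset HexVertex} {a : Sym2 HexVertex} {H : Site 2 → ℂ}
    (hH : IsPotential Λ a H) {k m : ℤ} (hup : upFace k m ∈ Λ) :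
    H ![k + 1, m] - H ![k, m] = (hexMidpoint (floorEdge k m) - hexCenter (upFace k m)) *
      hexParafermionicObservable Λ a hexCriticalFugacity (5 / 8) (floorEdge k m) := by
  have h1 : (![k + 1, m] : Site 2) = ![k, m] + Pi.single 0 1 := by
    ext i; fin_cases i <;> simp
  have hsv : (![k, m] : Site 2) ∈ hexFaceVertices (upFace k m) := by
    unfold upFace; rw [mem_hexFaceVertices_zero]; exact Or.inl rfl
  have htv : (![k + 1, m] : Site 2) ∈ hexFaceVertices (upFace k m) := by
    unfold upFace; rw [mem_hexFaceVertices_zero, h1]; exact Or.inr (Or.inl rfl)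
  have hb : (![k, m - 1] : Site 2) + Pi.single 1 1 = ![k, m] := by
    ext i; fin_cases i <;> simp
  have hsw : (![k, m] : Site 2) ∈ hexFaceVertices (belowFace k m) := by
    unfold belowFace; rw [mem_hexFaceVertices_one]; exact Or.inr (Or.inl hb.symm)
  have htw : (![k + 1, m] : Site 2) ∈ hexFaceVertices (belowFace k m) := by
    unfold belowFace; rw [mem_hexFaceVertices_one]
    refine Or.inr (Or.inr ?_)
    ext i; fin_cases i <;> simp
  have hne : (![k, m] : Site 2) ≠ ![k + 1, m] := by
    intro h; have := congrFun h 0; simp at this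
  have hor : 0 < ((starRingEnd ℂ) (triEmbed ![k + 1, m] - triEmbed ![k, m]) *
      (hexCenter (upFace k m) - triEmbed ![k, m])).im := by
    rw [h1, triEmbed_add, triEmbed_single_zero]
    unfold upFace
    simp only [hexCenter, add_sub_cancel_left, Fin.val_zero, Nat.cast_zero, zero_add, one_mul,
      map_one]
    simp [triZeta_im]
  have key := hH (upFace k m) hup (belowFace k m) (adj_belowFace_upFace k m).symm ![k, m] ![k + 1, m]
    hsv htv hsw htw hne hor
  rw [key]
  unfold floorEdge
  rw [Sym2.eq_swap]

/-- **`Re h_δ` is constant along the gate**: for ANY potential `H` of `F dz`, the real part of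
`(H(k + n, m) − H(k, m))/F(b)` vanishes along a flat floor segment carrying `b = floorEdge kb m`
and not carrying the root (each step is `gate_step_re_eq_zero`, or `F = 0` on the step edge when no
walk reaches it). [folklore] -/
theorem gate_re_eq_zero {Λ : Finset HexVertex}
    (hΛ : hexDomainSimplyConnected Λ) {u w : HexVertex} (huw : hexGraph.Adj u w) (hu : u ∉ Λ)
    (hw : w ∈ Λ) {m k₁ k₂ : ℤ} (hfl : IsFlatFloor Λ m k₁ k₂)
    (hroot : ∀ k : ℤ, k₁ ≤ k → k ≤ k₂ → floorEdge k m ≠ s(u, w))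
    {kb : ℤ} (hkb₁ : k₁ ≤ kb) (hkb₂ : kb ≤ k₂) (γb : HexMidEdgeSAW Λ s(u, w) (floorEdge kb m))
    {H : Site 2 → ℂ} (hH : IsPotential Λ s(u, w) H) :
    ∀ (n : ℕ) (k : ℤ), k₁ ≤ k → k + n ≤ k₂ + 1 →
      ((H ![k + n, m] - H ![k, m]) /
        hexParafermionicObservable Λ s(u, w) hexCriticalFugacity (5 / 8) (floorEdge kb m)).re = 0 := by
  classical
  intro n
  induction n with
  | zero => intro k _ _; simp
  | succ n ih =>
    intro k hk hkn
    have hkn' : k + (n : ℤ) ≤ k₂ := by push_cast at hkn; omega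
    have hsplit : H ![k + ((n + 1 : ℕ) : ℤ), m] - H ![k, m] =
        (H ![k + (n : ℤ) + 1, m] - H ![k + (n : ℤ), m]) + (H ![k + (n : ℤ), m] - H ![k, m]) := by
      push_cast; ring_nf
    rw [hsplit, add_div, Complex.add_re, ih k hk (by omega), add_zero,
      potential_floor_step hH (hfl (k + n) (by omega) hkn').1]
    by_cases hne : Nonempty (HexMidEdgeSAW Λ s(u, w) (floorEdge (k + n) m))
    · exact gate_step_re_eq_zero hΛ huw hu hw hfl hroot hkb₁ hkb₂ (by omega) hkn' γb hne.some
    · rw [not_nonempty_iff] at hne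
      simp [hexParafermionicObservable]

/-! #### The discrete minimum principle from the strict hull condition (lead reshape r2) -/



/-- Registered sub-goal `stub_halfPlaneInputs_gate` of crux stmt-CriticalPhenomena-14004 (line
`pick-half-plane`): the closed form of `gate_re_eq_zero` — every potential maps the flat gate through
the normaliser into a line (the imaginary axis of the normaliser's frame). [folklore] -/
theorem stub_halfPlaneInputs_gate : ∀ (Λ : Finset HexVertex), hexDomainSimplyConnected Λ → ∀ (u w : HexVertex), hexGraph.Adj u w → u ∉ Λ → w ∈ Λ → ∀ (m k₁ k₂ : ℤ), IsFlatFloor Λ m k₁ k₂ → (∀ k : ℤ, k₁ ≤ k → k ≤ k₂ → floorEdge k m ≠ s(u, w)) → ∀ (kb : ℤ), k₁ ≤ kb → kb ≤ k₂ → ∀ (γb : HexMidEdgeSAW Λ s(u, w) (floorEdge kb m)) (H : Site 2 → ℂ), IsPotential Λ s(u, w) H → ∀ (n : ℕ) (k : ℤ), k₁ ≤ k → k + n ≤ k₂ + 1 → ((H ![k + n, m] - H ![k, m]) / hexParafermionicObservable Λ s(u, w) hexCriticalFugacity (5 / 8) (floorEdge kb m)).re = 0 :=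
  fun _ hΛ _ _ huw hu hw _ _ _ hfl hroot _ hkb₁ hkb₂ γb _ hH => gate_re_eq_zero hΛ huw hu hw hfl hroot hkb₁ hkb₂ γb hH

end Summit.CriticalPhenomena.SAWScalingLimit.Theorems.PickHalfPlane.Gate

end
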